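import Summits.ABC.IUTFork.LDHSplitBadWitnessLocus
import Summits.ABC.IUTFork.LDHSplitLocusDisplayPoint
import HarnessLib

/-!
# The fork at [IUTchIII] Corollary 3.12, L-DH level: ADMISSIBLE points ON the split-bad locus — IV. Assembly:
# the split-bad point locus contains admissible `λ` of unbounded height; there the typed (U)-Corollary HOLDS at
# genuine Θ-data and v4's CONE binder `hreg` yields [IUTchIV] Thm. 1.10's display NON-VACUOUSLY

Proof-only file (D-0012; 0 definitions, no `Prop` fact) of the abc-iut cell (seat abc-iut-w5-d126), capstone of
`LDHSplitBadWitnessPoint/Poles/Locus.lean`. TAKES NO SIDE on [IUTchIII] Cor. 3.12 or [IUTchIV] Thm. 1.10 or on any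
author. S. Mochizuki, *IUT IV* [Mochizuki2012], Cor. 2.2 (ii) proof pp. 45–46 ((P1)–(P7)); [MochizukiGenEll2010]
Ex. 1.3 (ii) p. 5; abc-iut-s2-p4's `LDHSplitLocusDisplay(Point).lean` (p434756, p435674, p436687).

WHAT IS PROVED.
* `SplitBadWitness.exists_admissible_splitBadPoint_of` — over ANY model `F` of `ℚ(i)`: for every `H` there are
  `m`, `P = (F, i2^m/(1 + i2^{m+1})) ∈ UP ∩ CBData.std ∅` and a prime `l ≥ 7` with `AdmitsCore P`, `CondP2 P l`
  (`Cor22.condP2_of_lt`), `CondP5 P l`, `CondP6 P l` (the tree's PROVED (P4) ⟹ (P6) `Cor22.condP6_of_seven_le` at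
  `CBData.std ∅`), `H < log q^∀(P)`, AND the split-bad point condition `∀ p, Σ_{V|p} 𝟙[badPlacesAvoid P {2,l}]·Pr ≤ 1/2`.
* **`exists_admissible_splitBadPoint`** — the same at Mathlib's `CyclotomicField 4 ℚ`: the split-bad point locus of
  abc-iut-s2-p4 CONTAINS ADMISSIBLE POINTS OF UNBOUNDED HEIGHT (their docstrings' prose, now a kernel theorem).
* **`exists_admissible_cor312AtDatum`** — consequently (s2-p4 `PointDict.cor312AtDatum_of_splitBadPoint` + abc-iut-L5-t7
  `ThetaPartII.stub_thetaData`): there are admissible `(P, l)` of arbitrarily large height at which a GENUINE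
  Θ-volume datum EXISTS and the typed (U)-reading Corollary `Cor22.Cor312AtDatum P l` (with `Cor312NonarchAtDatum`)
  is a THEOREM — the (U)-line's disputed stub `stub_cor312` of crux `ThetaPartII` is TRUE, non-vacuously, on an
  explicit infinite admissible family (a statement about OUR typed objects; nothing about print's Cor. 3.12).
* **`exists_display_of_hreg`** / **`exists_display_of_hvol`** — from a hypothesis with the EXACT type of the CONE binder
  `hreg` of `Conditional.abc_of_S_v4` (resp. `hvol` of `abc_of_S_v3`), VERBATIM: for every `H` there are `η, P, l` with
  `IsEtaPrm η`, all binders of `Cor22.Thm110Legendre` at `(P, l)`, `H < log q^∀(P)` and `Cor22.Display P l η` — i.e.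
  `hreg` is [IUTchIV]-Thm-1.10-STRENGTH NON-VACUOUSLY (s2-p4 `thm110Display_of_hreg_of_splitBadPoint` read at the
  witnesses), and `exists_logQAvoid_le_of_hreg` — `hreg` bounds `log(q^{∤{2,l}})` explicitly at admissible points of
  arbitrarily large `log q^∀` (s2-p4 `logQAvoid_le_of_hreg_of_splitBadPoint`).
READING (for the C lead / s2 SCOREBOARD; no side taken): the «equivalent in strength to Thm 1.10 on the split-bad
locus» sentence of p434756/p435674 now quantifies over a NON-EMPTY, height-unbounded admissible set. HONEST SCOPE:
nothing here asserts abc, Cor. 3.12, Thm. 1.10 or `hreg`; typed ≠ proved.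
[cite: Mochizuki2012, IUTchIV Cor 2.2 (ii) proof (P1)-(P7) pp.45-46] [cite: MochizukiGenEll2010, Ex 1.3 (ii) p.5]
[claim: Mochizuki2012, status: disputed] for every IUT locator quoted.
-/

noncomputable section

namespace Summit.ABC.IUTFork

open NumberField IsDedekindDomain Finset
open Literature.IUT.HodgeTheaters Literature.IUT.LogVolume Literature.IUT.LogVolume.Cor22
open Literature.NumberTheory.DiophantineGeometry Literature.NumberTheory.DiophantineGeometry.GenEll
open Summit.ABC.ABC.Theorems

namespace SplitBadWitness

/-- **Admissible split-bad points over any model of `ℚ(i)`, unbounded height.** For every `H` there are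
`P = (F, i2^m/(1 + i2^{m+1})) ∈ UP ∩ CBData.std ∅` and a prime `l ≥ 7` with `AdmitsCore`, (P2), (P5), (P6),
`H < log q^∀(P)` and the split-bad point condition. [cite: Mochizuki2012, IUTchIV Cor 2.2 (ii) proof (P1)-(P7) pp.45-46]
[claim: Mochizuki2012, status: disputed] [cite: MochizukiGenEll2010, Ex 1.3 (ii) p.5] -/
theorem exists_admissible_splitBadPoint_of (F : Type) [Field F] [NumberField F] [IsCyclotomicExtension {4} ℚ F]
    {ζ : 𝓞 F} (hζ : IsPrimitiveRoot ζ 4) (H : ℝ) :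
    ∃ (P : NFPoint) (l : ℕ), P ∈ UP ∧ P ∈ (CBData.std ∅ (by simp)).toSet ∧ l.Prime ∧ 7 ≤ l ∧
      AdmitsCore P ∧ CondP2 P l ∧ CondP5 P l ∧ CondP6 P l ∧ H < logQForall P ∧
      ∀ (p : ℕ) [Fact p.Prime], ∑ V : placesOver P.F p,
        ((badPlacesAvoid P {2, l} : Finset _) : Set (HeightOneSpectrum (𝓞 P.F))).indicator (weight P.F) V.1 ≤ 1 / 2 := by
  classical
  obtain ⟨HK, hHK⟩ := condP6_of_seven_le (CBData.std ∅ (by simp))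
  -- height: choose `m` with `max H HK < m + 1 ≤ log(1 + 4^{m+1}) ≤ log q^∀(P_m)`
  set m : ℕ := ⌈max H HK⌉₊ with hm
  set Pm : NFPoint := ⟨F, (ζ : F) * 2 ^ m / (1 + (ζ : F) * 2 ^ (m + 1))⟩ with hPm
  have hbig : max H HK < logQForall Pm := by
    have h1 : max H HK ≤ (m : ℝ) := Nat.le_ceil _
    have h2 := succ_le_log m
    have h3 := log_le_logQForall hζ m
    linarith
  -- the prime `l`
  obtain ⟨l, hl, hlp⟩ := Nat.exists_infinite_primes
    (max 8 (max (⌈(Pm.degree : ℝ) * logQForall Pm / Real.log 2⌉₊ + 1) (1 + 4 ^ (m + 1) + 1)))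
  have hl8 : 8 ≤ l := (le_max_left _ _).trans hl
  have hl7 : 7 ≤ l := by omega
  have hlq : ⌈(Pm.degree : ℝ) * logQForall Pm / Real.log 2⌉₊ + 1 ≤ l :=
    ((le_max_left _ _).trans (le_max_right _ _)).trans hl
  have hlN : 1 + 4 ^ (m + 1) < l := by
    have := ((le_max_right _ _).trans (le_max_right _ _)).trans hl
    omega
  have hP2 : CondP2 Pm l := by
    apply condP2_of_lt
    have h2 := Nat.le_ceil ((Pm.degree : ℝ) * logQForall Pm / Real.log 2)
    have h3 : ((⌈(Pm.degree : ℝ) * logQForall Pm / Real.log 2⌉₊ + 1 : ℕ) : ℝ) ≤ l := by exact_mod_cast hlq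
    push_cast at h3
    linarith
  have hP5 : CondP5 Pm l := condP5 hζ m hlp hlN
  have hmem : Pm ∈ (CBData.std ∅ (by simp)).toSet := mem_std_empty hζ m
  have hUP : Pm ∈ UP := mem_UP hζ m
  have hP6 : CondP6 Pm l := hHK Pm hmem hUP l hlp hl7 hP2 hP5 (lt_of_le_of_lt (le_max_right _ _) hbig)
  exact ⟨Pm, l, hUP, hmem, hlp, hl7, admitsCore hζ m, hP2, hP5, hP6, lt_of_le_of_lt (le_max_left _ _) hbig,
    fun p _ => sum_indicator_weight_le_half hζ m {2, l} (by simp) p⟩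

end SplitBadWitness

/-- **NON-VACUITY OF THE SPLIT-BAD POINT LOCUS AMONG ADMISSIBLE POINTS, UNBOUNDED HEIGHT.** For every `H` there are a
point `P ∈ U_P` of the `λ`-line presented over its minimal field (here `ℚ(i) = CyclotomicField 4 ℚ`,
`λ = i2^m/(1 + i2^{m+1})`), lying in the compactly bounded subset `CBData.std ∅`, and a prime `l ≥ 7`, with
`AdmitsCore P`, `CondP2 P l`, `CondP5 P l`, `CondP6 P l`, `H < log q^∀(P)`, AND abc-iut-s2-p4's split-bad point
condition `∀ p, Σ_{V ∈ V(F)_p} 𝟙[V ∈ badPlacesAvoid P {2,l}]·Pr(V) ≤ 1/2`. [cite: Mochizuki2012, IUTchIV Cor 2.2 (ii) proof (P1)-(P7) pp.45-46]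
[claim: Mochizuki2012, status: disputed] [cite: MochizukiGenEll2010, Ex 1.3 (ii) p.5] -/
theorem exists_admissible_splitBadPoint (H : ℝ) :
    ∃ (P : NFPoint) (l : ℕ), P ∈ UP ∧ P ∈ (CBData.std ∅ (by simp)).toSet ∧ l.Prime ∧ 7 ≤ l ∧
      AdmitsCore P ∧ CondP2 P l ∧ CondP5 P l ∧ CondP6 P l ∧ H < logQForall P ∧
      ∀ (p : ℕ) [Fact p.Prime], ∑ V : placesOver P.F p,
        ((badPlacesAvoid P {2, l} : Finset _) : Set (HeightOneSpectrum (𝓞 P.F))).indicator (weight P.F) V.1 ≤ 1 / 2 := by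
  haveI : IsCyclotomicExtension {4} ℚ (CyclotomicField 4 ℚ) := CyclotomicField.isCyclotomicExtension 4 ℚ
  exact SplitBadWitness.exists_admissible_splitBadPoint_of (CyclotomicField 4 ℚ)
    (IsCyclotomicExtension.zeta_spec 4 ℚ (CyclotomicField 4 ℚ)).toInteger_isPrimitiveRoot H

/-- **THE TYPED (U)-READING COROLLARY HOLDS, NON-VACUOUSLY, AT ADMISSIBLE GENUINE DATA OF UNBOUNDED HEIGHT.** For every
`H` there are admissible `(P, l)` (all binders of `Cor22.Thm110Legendre`) with `H < log q^∀(P)` such that a genuine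
Θ-volume datum EXISTS at `(P, l)` (abc-iut-L5-t7 `ThetaPartII.stub_thetaData`) and `Cor22.Cor312NonarchAtDatum P l ∧
Cor22.Cor312AtDatum P l` (abc-iut-s2-p4 `PointDict.cor312AtDatum_of_splitBadPoint`): the (U)-line's stub `stub_cor312`
of crux `ThetaPartII` holds on an explicit infinite admissible family. A statement about OUR typed (U)-objects
((Ind1) = all capsule-index permutations); nothing asserted about print's Cor. 3.12. [claim: Mochizuki2012, status: disputed]
[cite: Mochizuki2012, IUTchIV Cor 2.2 (ii) proof (P1)-(P7) pp.45-46] -/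
theorem exists_admissible_cor312AtDatum (H : ℝ) :
    ∃ (P : NFPoint) (l : ℕ), P ∈ UP ∧ l.Prime ∧ 7 ≤ l ∧ AdmitsCore P ∧ CondP2 P l ∧ CondP5 P l ∧ CondP6 P l ∧
      H < logQForall P ∧ Nonempty (Cor22.ThetaVolumeDatumAt P l) ∧
      Cor22.Cor312NonarchAtDatum P l ∧ Cor22.Cor312AtDatum P l := by
  obtain ⟨P, l, hUP, -, hlp, hl7, hcore, h2, h5, h6, hH, hsplit⟩ := exists_admissible_splitBadPoint H
  exact ⟨P, l, hUP, hlp, hl7, hcore, h2, h5, h6, hH,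
    ThetaPartII.stub_thetaData P hUP l hlp (by omega) hcore h2 h5 h6, PointDict.cor312AtDatum_of_splitBadPoint hsplit⟩

/-- **v4's CONE binder `hreg` is [IUTchIV]-Thm-1.10-STRENGTH, NON-VACUOUSLY.** From a hypothesis with the EXACT type of
`hreg` of `Conditional.abc_of_S_v4` (p431657; = the registered stub `stub_hullRegime` of crux `ThetaPartII`): for every
`H` there are `η, P, l` with `IsEtaPrm η`, all binders of `Cor22.Thm110Legendre` at `(P, l)`, `H < log q^∀(P)`, and
`Cor22.Display P l η` (abc-iut-s2-p4 `thm110Display_of_hreg_of_splitBadPoint` at the witnesses of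
`exists_admissible_splitBadPoint`). Nothing asserts `hreg`. [claim: Mochizuki2012, status: disputed]
[cite: Mochizuki2012, IUTchIV Thm. 1.10 pp. 22–31] [cite: Mochizuki2012, IUTchIV Cor 2.2 (ii) proof p.46] -/
theorem exists_display_of_hreg
    (hreg : ∀ P : NFPoint, P ∈ UP → ∀ l : ℕ, l.Prime → 5 ≤ l →
      Cor22.AdmitsCore P → Cor22.CondP2 P l → Cor22.CondP5 P l → Cor22.CondP6 P l →
      ∀ T : Cor22.ThetaVolumeDatumAt P l,
        (letI := T.instFieldF; letI := T.instNumberFieldF; letI := T.instAlgebraF; letI := T.instFieldK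
         letI := T.instNumberFieldK; letI := T.instAlgebraK; letI := T.instFieldFbar; letI := T.instAlgebraFbar
         letI := T.instAlgebraKFbar; letI := T.instIsElliptic
         ¬ (∀ p ∈ T.I.supportPrimes, ∀ v w : placesOver (fieldOfModuli T.E) p,
            (Summit.ABC.IUTFork.DHData.ofInput T.I).logQloc p v = (Summit.ABC.IUTFork.DHData.ofInput T.I).logQloc p w)) →
        T.HullEstimateOf
          (((l : ℝ) + 1) / 4 *
            ((1 + 12 * (Cor22.dmod P : ℝ) / l) * (P.logDiff + Cor22.logCondAvoid P {2, l})
              + 2 * Real.log l + 52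
              + 20 / 3 * Real.log (((2 ^ 12 * 3 ^ 3 * 5 * Cor22.dmod P : ℕ) : ℝ) * (l : ℝ))
                * (Nat.primeCounting (2 ^ 12 * 3 ^ 3 * 5 * Cor22.dmod P * l) : ℝ))))
    (H : ℝ) :
    ∃ (η : ℝ) (P : NFPoint) (l : ℕ), IsEtaPrm η ∧ P ∈ UP ∧ l.Prime ∧ 7 ≤ l ∧ AdmitsCore P ∧ CondP2 P l ∧
      CondP5 P l ∧ CondP6 P l ∧ H < logQForall P ∧ Cor22.Display P l η := by
  obtain ⟨η, hη⟩ := exists_isEtaPrm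
  obtain ⟨P, l, hUP, -, hlp, hl7, hcore, h2, h5, h6, hH, hsplit⟩ := exists_admissible_splitBadPoint H
  exact ⟨η, P, l, hη, hUP, hlp, hl7, hcore, h2, h5, h6, hH,
    thm110Display_of_hreg_of_splitBadPoint hreg hη hUP hlp (by omega) hcore h2 h5 h6 hsplit⟩

/-- **The same from v3's `hvol`** (`Conditional.abc_of_S_v3`, p430884; binder type verbatim): Thm. 1.10's display at
admissible points of unbounded height. Nothing asserts `hvol`. [claim: Mochizuki2012, status: disputed]
[cite: Mochizuki2012, IUTchIV Thm. 1.10 pp. 22–31] -/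
theorem exists_display_of_hvol
    (hvol : ∀ P₀ : NFPoint, P₀ ∈ UP → ∀ l : ℕ, l.Prime → 5 ≤ l →
      Cor22.AdmitsCore P₀ → Cor22.CondP2 P₀ l → Cor22.CondP5 P₀ l → Cor22.CondP6 P₀ l →
        Cor22.HullVolumeAtDatum P₀ l (((l : ℝ) + 1) / 4 *
          ((1 + 12 * (Cor22.dmod P₀ : ℝ) / l) * (P₀.logDiff + Cor22.logCondAvoid P₀ {2, l})
            + 2 * Real.log l + 52
            + 20 / 3 * Real.log (((2 ^ 12 * 3 ^ 3 * 5 * Cor22.dmod P₀ : ℕ) : ℝ) * (l : ℝ))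
              * (Nat.primeCounting (2 ^ 12 * 3 ^ 3 * 5 * Cor22.dmod P₀ * l) : ℝ))))
    (H : ℝ) :
    ∃ (η : ℝ) (P : NFPoint) (l : ℕ), IsEtaPrm η ∧ P ∈ UP ∧ l.Prime ∧ 7 ≤ l ∧ AdmitsCore P ∧ CondP2 P l ∧
      CondP5 P l ∧ CondP6 P l ∧ H < logQForall P ∧ Cor22.Display P l η := by
  obtain ⟨η, hη⟩ := exists_isEtaPrm
  obtain ⟨P, l, hUP, -, hlp, hl7, hcore, h2, h5, h6, hH, hsplit⟩ := exists_admissible_splitBadPoint H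
  exact ⟨η, P, l, hη, hUP, hlp, hl7, hcore, h2, h5, h6, hH,
    thm110Display_of_hvol_of_splitBadPoint hvol hη hUP hlp (by omega) hcore h2 h5 h6 hsplit⟩

/-- **`hreg` bounds `log(q^{∤{2,l}})` explicitly at admissible points of arbitrarily large `log q^∀`** (abc-iut-s2-p4
`logQAvoid_le_of_hreg_of_splitBadPoint` at the witnesses): an explicit Szpiro-type consequence of the CONE binder on a
non-empty, height-unbounded admissible family. Nothing asserts `hreg`. [claim: Mochizuki2012, status: disputed]
[cite: Mochizuki2012, IUTchIV Thm. 1.10 Step (viii) p. 30–31] -/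
theorem exists_logQAvoid_le_of_hreg
    (hreg : ∀ P : NFPoint, P ∈ UP → ∀ l : ℕ, l.Prime → 5 ≤ l →
      Cor22.AdmitsCore P → Cor22.CondP2 P l → Cor22.CondP5 P l → Cor22.CondP6 P l →
      ∀ T : Cor22.ThetaVolumeDatumAt P l,
        (letI := T.instFieldF; letI := T.instNumberFieldF; letI := T.instAlgebraF; letI := T.instFieldK
         letI := T.instNumberFieldK; letI := T.instAlgebraK; letI := T.instFieldFbar; letI := T.instAlgebraFbar
         letI := T.instAlgebraKFbar; letI := T.instIsElliptic
         ¬ (∀ p ∈ T.I.supportPrimes, ∀ v w : placesOver (fieldOfModuli T.E) p,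
            (Summit.ABC.IUTFork.DHData.ofInput T.I).logQloc p v = (Summit.ABC.IUTFork.DHData.ofInput T.I).logQloc p w)) →
        T.HullEstimateOf
          (((l : ℝ) + 1) / 4 *
            ((1 + 12 * (Cor22.dmod P : ℝ) / l) * (P.logDiff + Cor22.logCondAvoid P {2, l})
              + 2 * Real.log l + 52
              + 20 / 3 * Real.log (((2 ^ 12 * 3 ^ 3 * 5 * Cor22.dmod P : ℕ) : ℝ) * (l : ℝ))
                * (Nat.primeCounting (2 ^ 12 * 3 ^ 3 * 5 * Cor22.dmod P * l) : ℝ))))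
    (H : ℝ) :
    ∃ (P : NFPoint) (l : ℕ), P ∈ UP ∧ l.Prime ∧ 7 ≤ l ∧ AdmitsCore P ∧ CondP2 P l ∧ CondP5 P l ∧ CondP6 P l ∧
      H < logQForall P ∧
      Cor22.logQAvoid P {2, l} ≤
        (((l : ℝ) + 1) / 4 *
            ((1 + 12 * (Cor22.dmod P : ℝ) / l) * (P.logDiff + Cor22.logCondAvoid P {2, l})
              + 2 * Real.log l + 52
              + 20 / 3 * Real.log (((2 ^ 12 * 3 ^ 3 * 5 * Cor22.dmod P : ℕ) : ℝ) * (l : ℝ))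
                * (Nat.primeCounting (2 ^ 12 * 3 ^ 3 * 5 * Cor22.dmod P * l) : ℝ))
          + ThetaVolumeInput.archLogTheta l) / (((l : ℝ) + 1) / 24 - 1 / (2 * l)) := by
  obtain ⟨P, l, hUP, -, hlp, hl7, hcore, h2, h5, h6, hH, hsplit⟩ := exists_admissible_splitBadPoint H
  exact ⟨P, l, hUP, hlp, hl7, hcore, h2, h5, h6, hH,
    logQAvoid_le_of_hreg_of_splitBadPoint hreg hUP hlp (by omega) hcore h2 h5 h6 hsplit⟩

/-- **v4's CONE binder `hreg` quantifies over a NON-EMPTY domain: its regime antecedent FIRES at admissible genuine data of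
unbounded height.** For every `H` there are admissible `(P, l)` with `H < log q^∀(P)` and a genuine Θ-volume datum `T` at
`(P, l)` (abc-iut-L5-t7 `ThetaPartII.stub_thetaData`) that is NOT slot-constant (abc-iut-s2-p4
`PointDict.not_slotConstant_of_badMass_le_half` with `badMass_le_half_of_splitBadPoint` at the witnesses of
`exists_admissible_splitBadPoint`) — so neither `hreg` (v4) nor the registered stub `stub_hullRegime` is provable by
vacuity of its antecedent. Nothing asserts `hreg`. [claim: Mochizuki2012, status: disputed]
[cite: Mochizuki2012, IUTchIV Thm. 1.10 Step (v) p. 27–28] [cite: Mochizuki2012, IUTchIV Cor 2.2 (ii) proof (P1)-(P7) pp.45-46] -/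
theorem exists_admissible_hregAntecedent (H : ℝ) :
    ∃ (P : NFPoint) (l : ℕ) (T : Cor22.ThetaVolumeDatumAt P l), P ∈ UP ∧ l.Prime ∧ 7 ≤ l ∧ AdmitsCore P ∧
      CondP2 P l ∧ CondP5 P l ∧ CondP6 P l ∧ H < logQForall P ∧
      (letI := T.instFieldF; letI := T.instNumberFieldF; letI := T.instAlgebraF; letI := T.instFieldK
       letI := T.instNumberFieldK; letI := T.instAlgebraK; letI := T.instFieldFbar; letI := T.instAlgebraFbar
       letI := T.instAlgebraKFbar; letI := T.instIsElliptic
       ¬ (∀ p ∈ T.I.supportPrimes, ∀ v w : placesOver (fieldOfModuli T.E) p,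
          (Summit.ABC.IUTFork.DHData.ofInput T.I).logQloc p v = (Summit.ABC.IUTFork.DHData.ofInput T.I).logQloc p w)) := by
  obtain ⟨P, l, hUP, -, hlp, hl7, hcore, h2, h5, h6, hH, hsplit⟩ := exists_admissible_splitBadPoint H
  obtain ⟨T⟩ := ThetaPartII.stub_thetaData P hUP l hlp (by omega) hcore h2 h5 h6
  exact ⟨P, l, T, hUP, hlp, hl7, hcore, h2, h5, h6, hH,
    PointDict.not_slotConstant_of_badMass_le_half T (PointDict.badMass_le_half_of_splitBadPoint T hsplit)⟩

end Summit.ABC.IUTFork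

end
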